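import Summits.AtomisticToContinuum.HydrodynamicLimit.Theses.JParityClosure
import Literature.Analysis.FluidPDE.HardSphereRegularGeometry

/-!
# Sketch — crux-ideate round 2, ideator 5 (planner-cruxidea-stmt-AtomisticToContinuum-13078-5-0)

First lemmas of the two round-2 idea cards for crux `JParityClosure.OddContactSymmetry` (stmt-13078):

* Card `metropolis-min-weight` (§B): the bounded twisted weight `min 1 (exp (−F))` — bounded by `1`
  (`minWeight_le_one`), parity-EXACT with a perfect estimator (`minWeight_residual_perfect`: the residual is
  identically `0`, contrast `OddContactSymmetryNegative.truncResidual_eq_zero_iff` for `min (1 + a′/a) L`),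
  and with a mollified estimator its odd residual vanishes iff twisted balance `a b′ = a′ b`
  (`minWeight_residual_eq_zero_iff`, same limit content as `OddContactSymmetryNegative.reweighted_odd_residual_eq_zero_iff`);
  `OddContactSymmetryMinWeight` = the crux VERBATIM with `(1 + Real.exp (-F z s i j))` ↦ `min 1 (Real.exp (-F z s i j))`
  (candidate repair C′₃, elaborates).
* Card `scattering-swap-shell-isotropy` (§A): `J` is the in/out swap of the scattering event
  (`J_swaps_in_out`), shell functions `Φ(v+w, ‖v−w‖)` are `J`-invariant (`shellFunction_J_invariant`), and the
  finite shell-rigidity lemma (`shell_rigidity`): the only solutions of the `n̂`-averaged twisted-balance equation on a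
  shell with isotropic scattering are the shell-constants.
-/

namespace Summit.AtomisticToContinuum.HydrodynamicLimit.Cruxes.OddContactSymmetry.IdeatorFive

open Literature.Analysis.FluidPDE Literature.MathematicalPhysics.KineticTheory
open scoped InnerProductSpace BigOperators

noncomputable section

/-! ## §B  The bounded twisted weight `min 1 (exp (−F))` -/

/-- The Metropolis weight is at most one. [folklore] -/
theorem minWeight_le_one (F : ℝ) : min 1 (Real.exp (-F)) ≤ 1 := min_le_left _ _

/-- The Metropolis weight is positive. [folklore] -/
theorem minWeight_pos (F : ℝ) : 0 < min 1 (Real.exp (-F)) := lt_min one_pos (Real.exp_pos _)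

/-- Termwise domination of the min-reweighted mark by the bare mark bound: the reweighted statistic is dominated by
`C · K_N[1]` (collision count), whatever the surprisal jump. [folklore] -/
theorem abs_mul_minWeight_le {Ψ C : ℝ} (F : ℝ) (h : |Ψ| ≤ C) : |Ψ * min 1 (Real.exp (-F))| ≤ C := by
  rw [abs_mul, abs_of_pos (minWeight_pos F)]
  calc |Ψ| * min 1 (Real.exp (-F)) ≤ C * 1 :=
        mul_le_mul h (minWeight_le_one F) (minWeight_pos F).le ((abs_nonneg Ψ).trans h)
    _ = C := mul_one C

/-- In terms of the availabilities: with `F = log b − log b′` (`b = h h_*` pre, `b′ = h′h′_*` post),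
`min 1 (exp (−F)) = min b b′ / b`. [folklore] -/
theorem minWeight_eq (b b' : ℝ) (hb : 0 < b) (hb' : 0 < b') :
    min 1 (Real.exp (-(Real.log b - Real.log b'))) = min b b' / b := by
  have hexp : Real.exp (-(Real.log b - Real.log b')) = b' / b := by
    rw [neg_sub, Real.exp_sub, Real.exp_log hb', Real.exp_log hb]
  rw [hexp, ← min_div_div_right hb.le, div_self hb.ne']

/-- **Parity exactness with a perfect estimator.**  `a·min(1, a′/a) − a′·min(1, a/a′) = 0` for all positive `a, a′`:
the min-reweighted contact weight is `J`-symmetric IDENTICALLY (contrast the truncated weight, exact only inside the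
window `a′/a ∈ [1/(L−1), L−1]`, `OddContactSymmetryNegative.truncResidual_eq_zero_iff`). [folklore] -/
theorem minWeight_residual_perfect (a a' : ℝ) (ha : 0 < a) (ha' : 0 < a') :
    a * min 1 (a' / a) - a' * min 1 (a / a') = 0 := by
  rw [mul_min_of_nonneg _ _ ha.le, mul_min_of_nonneg _ _ ha'.le, mul_one, mul_one,
    mul_div_cancel₀ _ ha.ne', mul_div_cancel₀ _ ha'.ne', min_comm a' a, sub_self]

/-- **The min-reweighted odd residual with a mollified estimator.**  `a` = incoming contact density at `q`, `a′` at
`J q`; `b, b′` the (mollified) availabilities: `a·min(1,b′/b) − a′·min(1,b/b′) = (a b′ − a′ b)·min(b,b′)/(b b′)`. [folklore] -/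
theorem minWeight_residual (a a' b b' : ℝ) (hb : 0 < b) (hb' : 0 < b') :
    a * min 1 (b' / b) - a' * min 1 (b / b') = (a * b' - a' * b) * (min b b' / (b * b')) := by
  have h1 : min 1 (b' / b) = min b b' / b := by
    rw [← min_div_div_right hb.le, div_self hb.ne']
  have h2 : min 1 (b / b') = min b b' / b' := by
    rw [min_comm b b', ← min_div_div_right hb'.le, div_self hb'.ne']
  rw [h1, h2]
  field_simp

/-- **Same limit content as the filed weight.**  The min-reweighted weight is `J`-even at `q` iff twisted balance
`a b′ = a′ b` (cf. `OddContactSymmetryNegative.reweighted_odd_residual_eq_zero_iff` for `1 + b′/b`). [folklore] -/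
theorem minWeight_residual_eq_zero_iff (a a' b b' : ℝ) (hb : 0 < b) (hb' : 0 < b') :
    a * min 1 (b' / b) - a' * min 1 (b / b') = 0 ↔ a * b' = a' * b := by
  rw [minWeight_residual a a' b b' hb hb', mul_eq_zero, sub_eq_zero]
  have hpos : 0 < min b b' / (b * b') := div_pos (lt_min hb hb') (mul_pos hb hb')
  constructor
  · rintro (h | h)
    · exact h
    · exact absurd h hpos.ne'
  · exact fun h => Or.inl h

/-- **The collisional Maxwell defect is a bounded nonnegative mark.**  `0 ≤ 1 − min(1, e^{−F}) ≤ 1`. [folklore] -/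
theorem maxwellDefect_mem (F : ℝ) : 0 ≤ 1 - min 1 (Real.exp (-F)) ∧ 1 - min 1 (Real.exp (-F)) ≤ 1 :=
  ⟨sub_nonneg.2 (minWeight_le_one F), by linarith [minWeight_pos F]⟩

/-- **The Metropolis split, termwise at finite `N`.**  For a bounded mark, the min-reweighted term differs from the
UNWEIGHTED term by at most `C ×` the parity-free Maxwell-defect term: summed over collisions,
`|K_N[χ g Ψ·min(1,e^{−F})] − K_N[χ g Ψ]| ≤ C · K_N[χ g (1 − min(1,e^{−F}))]` — so C′₃ ⟸ (F₃: unweighted odd statistic → 0)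
∧ (M₃: collisional Maxwell defect → 0), both BOUNDED statistics. [folklore] -/
theorem metropolis_split {Ψ C : ℝ} (F : ℝ) (h : |Ψ| ≤ C) :
    |Ψ * min 1 (Real.exp (-F)) - Ψ| ≤ C * (1 - min 1 (Real.exp (-F))) := by
  have hd := (maxwellDefect_mem F).1
  have : Ψ * min 1 (Real.exp (-F)) - Ψ = -(Ψ * (1 - min 1 (Real.exp (-F)))) := by ring
  rw [this, abs_neg, abs_mul, abs_of_nonneg hd]
  exact mul_le_mul_of_nonneg_right h hd

/-- **Limit content of the Maxwell defect.**  With availabilities `b = hh_*` (pre) and `b′ = h′h′_*` (post):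
`b·(1 − min(1, b′/b)) = max (b − b′) 0`, the positive part of the availability drop; integrated against the (J-even part
of the) contact law it is half the `L¹(flux)` distance between pre- and post-availability — zero iff `hh_* = h′h′_*` on the
collision support, i.e. (with a thick support) iff `h` is a local Maxwellian. [folklore] -/
theorem maxwellDefect_eq_posPart (b b' : ℝ) (hb : 0 < b) (_hb' : 0 < b') :
    b * (1 - min 1 (b' / b)) = max (b - b') 0 := by
  rcases le_total b' b with hle | hle
  · have h1 : b' / b ≤ 1 := (div_le_one hb).2 hle
    rw [min_eq_right h1, max_eq_left (sub_nonneg.2 hle)]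
    field_simp
  · have h1 : 1 ≤ b' / b := (one_le_div hb).2 hle
    rw [min_eq_left h1, max_eq_right (sub_nonpos.2 hle)]
    ring

/-- **C′₃ — the crux with the bounded twisted weight.**  VERBATIM `JParityClosure.OddContactSymmetry` with the single
token change `(1 + Real.exp (-F z s i j))` ↦ `min 1 (Real.exp (-F z s i j))`; no new quantifier, no mark restriction,
statistic dominated by `C·K_N[1]`. [folklore] -/
def OddContactSymmetryMinWeight : Prop :=
  ∃ η₀ : ℝ, 0 < η₀ ∧ ∀ (a₀ θ₀ : Literature.MathematicalPhysics.KineticTheory.T3 → ℝ) (u₀ : Literature.MathematicalPhysics.KineticTheory.T3 → Literature.MathematicalPhysics.KineticTheory.V3), Continuous a₀ → Continuous θ₀ → Continuous u₀ → (∀ x, 0 < a₀ x) → (∀ x, 0 < θ₀ x) → ∃ σ₀ : ℝ, 0 < σ₀ ∧ ∀ σ : ℝ, 0 < σ → σ < σ₀ → ∀ Φ : (N : ℕ) → Literature.Analysis.FluidPDE.HardSphereFlow (Literature.Analysis.FluidPDE.Torus.geometry (Fin 3)) (Literature.MathematicalPhysics.KineticTheory.hsDiameter σ N) (N + 1), ∀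 τ : ℝ, 0 < τ → ∀ χ : ℝ × UnitAddTorus (Fin 3) → ℝ, Continuous χ → ∀ g : ℝ → ℝ, Continuous g → (∀ a, η₀ ≤ a → g a = 0) → ∀ Ψ : EuclideanSpace ℝ (Fin 3) × EuclideanSpace ℝ (Fin 3) × EuclideanSpace ℝ (Fin 3) → ℝ, Continuous Ψ → (∃ C : ℝ, ∀ q, |Ψ q| ≤ C) → (∀ (n v w : EuclideanSpace ℝ (Fin 3)), ‖n‖ = 1 → Ψ (-n, (Literature.Analysis.FluidPDE.reflectVel n (v, w)).1, (Literature.Analysis.FluidPDE.reflectVel n (v, w)).2) = -Ψ (n, v, w)) → ∀ η δ : ℝ, 0 < η → 0 < δ → ∃ r₀ : ℝ, 0 < r₀ ∧ ∀ r ϑ : ℝ, 0 < r → r < r₀ → 0 < ϑ → ϑ < r₀ → ∃ N₀ : ℕ, ∀ N : ℕ, N₀ ≤ N → let ε := Literature.MathematicalPhysics.KineticTheory.hsDiameter σ N; let G := Literature.Analysis.FluidPDE.Torus.geometry (Fin 3); let γ := fun z (s : ℝ) => (Φ N).flow s z; let bx : UnitAddTorus (Fin 3) → UnitAddTorus (Fin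 3) → ℝ := fun x y => 3 / (Real.pi * r ^ 3) * max (1 - Literature.Analysis.FluidPDE.Torus.euclidDist x y / r) 0; let ρm := fun z s (x₀ : UnitAddTorus (Fin 3)) => ∫ q, bx q.1 x₀ ∂(Literature.Analysis.FluidPDE.empiricalMeasure (γ z s)); let hm := fun z s (x₀ : UnitAddTorus (Fin 3)) (v : EuclideanSpace ℝ (Fin 3)) => ∫ q, bx q.1 x₀ * Literature.Analysis.FluidPDE.localMaxwellian 1 (ϑ ^ 2) v q.2 ∂(Literature.Analysis.FluidPDE.empiricalMeasure (γ z s)); let pv := fun z s (i j : Fin (N + 1)) => Literature.Analysis.FluidPDE.reflectVel (G.sepVec (γ z s i).1 (γ z s j).1) ((γ z s i).2, (γ z s j).2); let F := fun z s (i j : Fin (N + 1)) => Real.log (hm z s (γ z s i).1 (pv z s i j).1) + Real.log (hm z s (γ z s i).1 (pv z s i j).2) - Real.log (hm z s (γ z s i).1 (γ z s i).2) - Real.log (hm z s (γ z s i).1 (γ z s j).2); let Kc := fun (Fn : Literature.Analysis.FluidPDE.Config (N + 1) (Fin 3) Literature.MathematicalPhysics.KineticTheory.T3 → ℝ → Fin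 (N + 1) → Fin (N + 1) → ℝ) z => ε / (N + 1 : ℝ) * ∑ᶠ (s : ℝ) (_ : s ∈ Literature.Analysis.FluidPDE.collisionTimes G ε (γ z) ∩ Set.Icc 0 τ), ∑ i : Fin (N + 1), ∑ j : Fin (N + 1), (if i ≠ j ∧ ‖G.sepVec (γ z s i).1 (γ z s j).1‖ = ε then Fn z s i j else 0); let D := fun z => Kc (fun z s i j => χ (s, (γ z s i).1) * g (σ ^ 3 * ρm z s (γ z s i).1) * (Ψ (ε⁻¹ • G.sepVec (γ z s i).1 (γ z s j).1, (pv z s i j).1, (pv z s i j).2) * min 1 (Real.exp (-F z s i j)))) z; Literature.MathematicalPhysics.KineticTheory.localGibbsLaw σ a₀ u₀ θ₀ N (Φ N) {z | η < |D z|} ≤ ENNReal.ofReal δ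

/-! ## §A  `J` is the in/out swap of the scattering event; shell rigidity -/

/-- **`J` swaps incoming and outgoing data.**  For an event with impact direction `n`, incoming pair `p` and outgoing
pair `p⁺ = reflectVel n p`: the `J`-image event `(−n, p⁺)` has the same total momentum, incoming relative velocity
equal to the old OUTGOING one (by definition) and outgoing pair equal to the old INCOMING one. [folklore] -/
theorem J_swaps_in_out (n : V3) (p : V3 × V3) :
    (reflectVel n p).1 + (reflectVel n p).2 = p.1 + p.2 ∧ reflectVel (-n) (reflectVel n p) = p := by
  exact ⟨reflectVel_fst_add_reflectVel_snd n p, by rw [reflectVel_neg, reflectVel_reflectVel]⟩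

/-- The relative speed is a collision invariant: `‖v′ − w′‖ = ‖v − w‖` (parallelogram law + conservation of momentum
and energy). [folklore] -/
theorem norm_relVel_reflectVel (n : V3) (p : V3 × V3) :
    ‖(reflectVel n p).1 - (reflectVel n p).2‖ = ‖p.1 - p.2‖ := by
  have hE := norm_sq_reflectVel_fst_add_norm_sq_reflectVel_snd n p
  have hP := reflectVel_fst_add_reflectVel_snd n p
  have h1 := norm_sub_sq_real (reflectVel n p).1 (reflectVel n p).2
  have h2 := norm_add_sq_real (reflectVel n p).1 (reflectVel n p).2
  have h3 := norm_sub_sq_real p.1 p.2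
  have h4 := norm_add_sq_real p.1 p.2
  have hsq : ‖(reflectVel n p).1 - (reflectVel n p).2‖ ^ 2 = ‖p.1 - p.2‖ ^ 2 := by
    rw [hP] at h2
    linarith
  exact (pow_left_inj₀ (norm_nonneg _) (norm_nonneg _) two_ne_zero).mp hsq

/-- **Shell functions are `J`-invariant.**  Any function of the pair's collision invariants `(v + w, ‖v − w‖)` takes
the same value on `q` and `J q`; so a contact correlation of the form `γ = Φ(P, |g|)` satisfies twisted balance
(card A: under impact-uniformity this is also NECESSARY, `shell_rigidity`). [folklore] -/
theorem shellFunction_J_invariant (Φ : V3 → ℝ → ℝ) (n : V3) (p : V3 × V3) :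
    Φ ((reflectVel n p).1 + (reflectVel n p).2) ‖(reflectVel n p).1 - (reflectVel n p).2‖ =
      Φ (p.1 + p.2) ‖p.1 - p.2‖ := by
  rw [reflectVel_fst_add_reflectVel_snd, norm_relVel_reflectVel]

/-- **Shell rigidity (finite form).**  On a finite non-empty set of relative-velocity directions with the UNIFORM
(isotropic-scattering) average `𝔼`, if a positive availability `u` and a correlation profile `G` satisfy the
`n̂`-averaged twisted-balance equation `(u i + 𝔼u)·G i = u i·𝔼G + 𝔼(G·u)` at every direction, then `G` is
constant: no exotic (anisotropic) solution exists, for ANY availability profile `u`. [folklore] -/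
theorem shell_rigidity {ι : Type*} [Fintype ι] [Nonempty ι] (u G : ι → ℝ) (hu : ∀ i, 0 < u i)
    (h : ∀ i, (u i + (∑ j, u j) / Fintype.card ι) * G i =
      u i * ((∑ j, G j) / Fintype.card ι) + (∑ j, G j * u j) / Fintype.card ι) :
    ∀ i j, G i = G j := by
  classical
  set c : ℝ := (Fintype.card ι : ℝ) with hc_def
  have hc : 0 < c := by
    rw [hc_def]; exact_mod_cast Fintype.card_pos
  set Ubar : ℝ := (∑ j, u j) / c with hU
  set Gbar : ℝ := (∑ j, G j) / c with hG
  set K : ℝ := (∑ j, G j * u j) / c with hK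
  have hUpos : 0 < Ubar := by
    rw [hU]; exact div_pos (Finset.sum_pos (fun i _ => hu i) Finset.univ_nonempty) hc
  -- Claim 1: (u i + Ubar) * (G i - Gbar) = κ for every i
  set κ : ℝ := K - Ubar * Gbar with hκ
  have h1 : ∀ i, G i - Gbar = κ / (u i + Ubar) := by
    intro i
    have hden : 0 < u i + Ubar := add_pos (hu i) hUpos
    rw [eq_div_iff hden.ne']
    have := h i
    rw [hκ]
    linear_combination this
  -- Claim 2: the deviations sum to zero
  have h2 : ∑ i, (G i - Gbar) = 0 := by
    rw [Finset.sum_sub_distrib, Finset.sum_const, Finset.card_univ, nsmul_eq_mul, hG]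
    field_simp
    ring
  have h3 : κ * ∑ i, (1 / (u i + Ubar)) = 0 := by
    rw [Finset.mul_sum]
    have : ∑ i, κ * (1 / (u i + Ubar)) = ∑ i, (G i - Gbar) := by
      refine Finset.sum_congr rfl (fun i _ => ?_)
      rw [h1 i]; ring
    rw [this, h2]
  have hSpos : 0 < ∑ i, (1 / (u i + Ubar)) :=
    Finset.sum_pos (fun i _ => by have := add_pos (hu i) hUpos; positivity) Finset.univ_nonempty
  have hκ0 : κ = 0 := by
    rcases mul_eq_zero.mp h3 with h | h
    · exact h
    · exact absurd h hSpos.ne'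
  have hconst : ∀ i, G i = Gbar := by
    intro i
    have := h1 i
    rw [hκ0, zero_div, sub_eq_zero] at this
    exact this
  intro i j
  rw [hconst i, hconst j]

end

end Summit.AtomisticToContinuum.HydrodynamicLimit.Cruxes.OddContactSymmetry.IdeatorFive
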